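import Mathlib

/-!
# A local factor with small support is a positive volume (support, seat p1)

The bookkeeping of «at a finite place of `S`, `f_v` = the characteristic function of a small neighbourhood `U_v`
of `γ₀` and the characters are locally constant, so the orbital integral is `vol(U_v ∩ …) > 0`»: on a measurable
space with a topology, an open non-empty set `W` of finite measure, and a function `ψ` equal to `1` on `W`, the
integral of `W.indicator ψ` is the real `μ.real W`, a positive number (`integral_indicator_eq_volume`,
`integral_indicator_pos`) — for a measure positive on open sets (every Haar measure).

Nothing here is about any group, character, or orbital integral: it is «a locally constant character integrated
over a small open set on which it is trivial gives the volume of the set».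
Blind lane: Mathlib only; no sorry; axioms ⊆ {propext, Classical.choice, Quot.sound}.
-/

namespace Summit.Ventures.HodgeRepro2.T7SupportLocalFactorPositive

open MeasureTheory

variable {X : Type*} [MeasurableSpace X] (μ : Measure X)

/-- the integral of `W.indicator ψ` for `ψ = 1` on the measurable set `W` is the volume `μ.real W` -/
theorem integral_indicator_eq_volume (W : Set X) (hW : MeasurableSet W) (ψ : X → ℂ)
    (hψ : ∀ x ∈ W, ψ x = 1) : ∫ x, W.indicator ψ x ∂μ = (μ.real W : ℂ) := by
  rw [integral_indicator hW, setIntegral_congr_fun hW (fun x hx => hψ x hx), setIntegral_const]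
  simp

variable [TopologicalSpace X] [OpensMeasurableSpace X] [μ.IsOpenPosMeasure]

/-- **a local factor with small support is positive**: for `W` open, non-empty, of finite measure, and `ψ = 1`
on `W`, the integral of `W.indicator ψ` is real and positive. -/
theorem integral_indicator_pos (W : Set X) (hW : IsOpen W) (hne : W.Nonempty) (hfin : μ W ≠ ⊤)
    (ψ : X → ℂ) (hψ : ∀ x ∈ W, ψ x = 1) :
    0 < (∫ x, W.indicator ψ x ∂μ).re ∧ (∫ x, W.indicator ψ x ∂μ).im = 0 := by
  rw [integral_indicator_eq_volume μ W hW.measurableSet ψ hψ]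
  refine ⟨?_, by simp⟩
  rw [Complex.ofReal_re, measureReal_def]
  exact ENNReal.toReal_pos (hW.measure_pos μ hne).ne' hfin

/-- in particular the local factor is non-zero -/
theorem integral_indicator_ne_zero (W : Set X) (hW : IsOpen W) (hne : W.Nonempty) (hfin : μ W ≠ ⊤)
    (ψ : X → ℂ) (hψ : ∀ x ∈ W, ψ x = 1) : ∫ x, W.indicator ψ x ∂μ ≠ 0 := by
  intro h
  have := (integral_indicator_pos μ W hW hne hfin ψ hψ).1
  rw [h, Complex.zero_re] at this
  exact lt_irrefl _ this

end Summit.Ventures.HodgeRepro2.T7SupportLocalFactorPositive
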